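import Mathlib.Analysis.Calculus.Deriv.Inv
import Mathlib.Analysis.Calculus.Deriv.MeanValue
import Mathlib.Analysis.SpecialFunctions.ExpDeriv
import Mathlib.Topology.Order.Monotone
import HarnessLib

/-!
# The log-convexity (Dirichlet quotient) lemma behind backward uniqueness of parabolic equations

Analysis/ODE proof file (theorems only; no definitions, no named facts). The backward uniqueness
theorem for an abstract parabolic equation `w' + νAw = h(t, w)` with `‖h‖ ≤ k‖A^{1/2}w‖ + k'‖w‖`
(Temam 1997, Ch. III §6.1, Lemmas 6.1–6.2; the log-convexity method of Agmon–Nirenberg, in the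
form of Bardos–Tartar and Ghidaglia, Remark 6.1 there) only ever manipulates two real functions
of time, the energy `E(t) = ‖w(t)‖²` and the Dirichlet form `V(t) = ‖A^{1/2}w(t)‖²`, through

* the **energy inequality** `E' ≥ -(αV + βE)` (from `½E' = -νV + ⟨h, w⟩`), and
* the **Dirichlet-quotient (Riccati) law** `V'E - VE' ≤ K (V + E) E`, i.e. `Λ' ≤ K(Λ + 1)` for
  the Dirichlet quotient `Λ = V/E` on every interval where `E > 0` (Temam's (6.9)/(6.11):
  `½Λ' = -‖(A - Λ)w‖²/‖w‖² + ⟨(A - Λ)w, h⟩/‖w‖² ≤ ‖h‖²/(2‖w‖²)`).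

This file proves the real-variable conclusion (Temam's Lemma 6.2): **if moreover `E(b) = 0`,
then `E ≡ 0` on `[a, b]`** (`Literature.Analysis.ODE.eq_zero_of_dirichletQuotient_law`). Proof:
if `E(t₀) > 0`, let `t₁ ∈ (t₀, b]` be the first zero of `E` after `t₀`; on `[t₀, t₁)` the
function `(Λ + 1)e^{-Kt}` is non-increasing, so `Λ ≤ B` there; then `(E e^{Mt})' =
(E' + ME)e^{Mt} ≥ (M - αΛ - β)E e^{Mt} ≥ 0` for `M = αB + β`, so `E e^{Mt}` is non-decreasing on
`[t₀, t₁]` and `E(t₁) ≥ E(t₀)e^{-M(t₁ - t₀)} > 0`, a contradiction. Only the mean value theorem is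
used (`antitoneOn_of_hasDerivWithinAt_nonpos`, `monotoneOn_of_hasDerivWithinAt_nonneg`); the
derivatives are one-sided within `[a, b]` (`HasDerivWithinAt … (Icc a b) t`), the form produced by
differentiating space integrals of classical solutions on a compact time interval, and the two
inequalities are only required where `E > 0`. The forward reading of the same fact — **positivity
propagates**: `E(t₀) > 0 ⇒ E(t) > 0` for `t ∈ [t₀, b]` — is
`Literature.Analysis.ODE.pos_of_dirichletQuotient_law`.

The PDE input (the two inequalities for the difference of two classical Navier–Stokes solutions on
the flat torus) and the resulting backward uniqueness theorem are in
`Literature/Analysis/FunctionSpaces/TorusClassicalNSBackwardUniqueness.lean`. What is NOT here: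
Temam's sharper integrated form (6.10) with `k ∈ L²(0, T)` (we assume bounded coefficients, which
is what smooth solutions on a compact interval provide), and the Agmon–Nirenberg second-order
(in time) version.

## Mathlib / tree search

Mathlib: `antitoneOn_of_hasDerivWithinAt_nonpos`, `monotoneOn_of_hasDerivWithinAt_nonneg`,
`HasDerivWithinAt.hasDerivAt`, `IsClosed.csInf_mem`, `csInf_le`,
`ContinuousOn.preimage_isClosed_of_isClosed`, `HasDerivAt.div/.mul/.exp`. Tree: the singular-weight
variant of the same argument (`(-t)^{2C²}Λ` non-increasing, threshold `2C² < 1`) is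
`Summit.…RellichScarScarRigidity.logConvexity_lowerBound` (Summits side, not importable here);
`lean search "dirichletQuotient|logConvexity|backward_unique"` in `Literature/`: nothing.

## References

* R. Temam, *Infinite-Dimensional Dynamical Systems in Mechanics and Physics*, 2nd ed., Springer
  1997, Ch. III §6.1, Lemma 6.1 ((6.9)–(6.11)) and Lemma 6.2 ((6.12)–(6.14)). [Temam1997]
* P. Constantin, C. Foias, *Navier–Stokes Equations*, Univ. Chicago Press 1988, Ch. 12,
  Theorem 12.2 (backward uniqueness of strong solutions). [ConstantinFoiasNSE1988]
-/

noncomputable section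

open Set Filter Topology

namespace Literature.Analysis.ODE

/-- **Backward uniqueness by log-convexity (Temam 1997, Ch. III, Lemma 6.2, real-variable core).**
Let `E, V : ℝ → ℝ` have one-sided derivatives `E', V'` within `[a, b]`, `E, V ≥ 0` there, and
suppose that at every `t ∈ [a, b]` with `E(t) > 0` the energy inequality `E' ≥ -(αV + βE)` and the
Dirichlet-quotient law `V'E - VE' ≤ K(V + E)E` hold (`K, α ≥ 0`). If `E(b) = 0` then `E ≡ 0` on
`[a, b]`: on an interval of positivity `[t₀, t₁)` ending at a zero `t₁` of `E`, the quotient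
`Λ = V/E` obeys `Λ' ≤ K(Λ + 1)`, hence stays bounded, hence `(log E)' ≥ -M` and `E(t₁) > 0`.
[cite: Temam1997, Ch. III §6.1 Lemma 6.2] -/
theorem eq_zero_of_dirichletQuotient_law {a b K α β : ℝ} {E V E' V' : ℝ → ℝ}
    (hE : ∀ t ∈ Icc a b, HasDerivWithinAt E (E' t) (Icc a b) t)
    (hV : ∀ t ∈ Icc a b, HasDerivWithinAt V (V' t) (Icc a b) t)
    (hE0 : ∀ t ∈ Icc a b, 0 ≤ E t) (hV0 : ∀ t ∈ Icc a b, 0 ≤ V t) (hK : 0 ≤ K) (hα : 0 ≤ α)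
    (hlow : ∀ t ∈ Icc a b, 0 < E t → -(α * V t + β * E t) ≤ E' t)
    (hquot : ∀ t ∈ Icc a b, 0 < E t → V' t * E t - V t * E' t ≤ K * (V t + E t) * E t)
    (hb : E b = 0) {t₀ : ℝ} (ht₀ : t₀ ∈ Icc a b) : E t₀ = 0 := by
  by_contra hne
  have hpos : 0 < E t₀ := lt_of_le_of_ne (hE0 t₀ ht₀) (Ne.symm hne)
  have hEc : ContinuousOn E (Icc a b) := fun s hs => (hE s hs).continuousWithinAt
  have hVc : ContinuousOn V (Icc a b) := fun s hs => (hV s hs).continuousWithinAt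
  -- the first zero `t₁` of `E` after `t₀`
  set Z : Set ℝ := Icc t₀ b ∩ E ⁻¹' {0} with hZ_def
  have hZsub : Icc t₀ b ⊆ Icc a b := Icc_subset_Icc ht₀.1 le_rfl
  have hZc : IsClosed Z :=
    (hEc.mono hZsub).preimage_isClosed_of_isClosed isClosed_Icc isClosed_singleton
  have hZne : Z.Nonempty := ⟨b, ⟨ht₀.2, le_rfl⟩, hb⟩
  have hZbdd : BddBelow Z := ⟨t₀, fun s hs => hs.1.1⟩
  set t₁ : ℝ := sInf Z with ht₁_def
  have ht₁Z : t₁ ∈ Z := hZc.csInf_mem hZne hZbdd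
  have hEt₁ : E t₁ = 0 := ht₁Z.2
  have ht₀t₁ : t₀ < t₁ := by
    rcases eq_or_lt_of_le ht₁Z.1.1 with h | h
    · rw [← h] at hEt₁
      exact absurd hEt₁ hne
    · exact h
  have ht₁b : t₁ ≤ b := ht₁Z.1.2
  have hIsub : Icc t₀ t₁ ⊆ Icc a b := fun s hs => ⟨ht₀.1.trans hs.1, hs.2.trans ht₁b⟩
  -- `E > 0` on `[t₀, t₁)`
  have hEpos : ∀ s ∈ Ico t₀ t₁, 0 < E s := by
    intro s hs
    refine lt_of_le_of_ne (hE0 s (hIsub (Ico_subset_Icc_self hs))) fun h0 => ?_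
    have hsZ : s ∈ Z := ⟨⟨hs.1, hs.2.le.trans ht₁b⟩, h0.symm⟩
    exact absurd (csInf_le hZbdd hsZ) (not_le.2 hs.2)
  -- two-sided derivatives at interior points
  have hnhds : ∀ s ∈ Ioo t₀ t₁, Icc a b ∈ 𝓝 s := fun s hs =>
    Icc_mem_nhds (ht₀.1.trans_lt hs.1) (hs.2.trans_le ht₁b)
  have hEd : ∀ s ∈ Ioo t₀ t₁, HasDerivAt E (E' s) s := fun s hs =>
    (hE s (hIsub (Ioo_subset_Icc_self hs))).hasDerivAt (hnhds s hs)
  have hVd : ∀ s ∈ Ioo t₀ t₁, HasDerivAt V (V' s) s := fun s hs =>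
    (hV s (hIsub (Ioo_subset_Icc_self hs))).hasDerivAt (hnhds s hs)
  -- Step 1: `(Λ + 1) e^{-Kt}` is non-increasing on `[t₀, t₁)`, `Λ = V/E`.
  set Λ : ℝ → ℝ := fun s => V s / E s with hΛ_def
  set F : ℝ → ℝ := fun s => (Λ s + 1) * Real.exp (-(K * s)) with hF_def
  set F' : ℝ → ℝ := fun s =>
    ((V' s * E s - V s * E' s) / E s ^ 2 - K * (Λ s + 1)) * Real.exp (-(K * s)) with hF'_def
  have hFd : ∀ s ∈ Ioo t₀ t₁, HasDerivAt F (F' s) s := by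
    intro s hs
    have hEs : E s ≠ 0 := (hEpos s (Ioo_subset_Ico_self hs)).ne'
    have hΛd : HasDerivAt Λ ((V' s * E s - V s * E' s) / E s ^ 2) s :=
      (hVd s hs).div (hEd s hs) hEs
    have hexp : HasDerivAt (fun y => Real.exp (-(K * y))) (Real.exp (-(K * s)) * -(K * 1)) s :=
      ((hasDerivAt_id' s).const_mul K).neg.exp
    have h := (hΛd.add_const 1).mul hexp
    refine h.congr_deriv ?_
    simp only [hF'_def]
    ring
  have hFsign : ∀ s ∈ Ioo t₀ t₁, F' s ≤ 0 := by
    intro s hs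
    have hEs : 0 < E s := hEpos s (Ioo_subset_Ico_self hs)
    have hq := hquot s (hIsub (Ioo_subset_Icc_self hs)) hEs
    have h1 : (V' s * E s - V s * E' s) / E s ^ 2 ≤ K * (Λ s + 1) := by
      rw [div_le_iff₀ (pow_pos hEs 2)]
      have e : K * (Λ s + 1) * E s ^ 2 = K * (V s + E s) * E s := by
        simp only [hΛ_def]
        field_simp
      rw [e]
      exact hq
    exact mul_nonpos_of_nonpos_of_nonneg (by linarith) (Real.exp_pos _).le
  have hF : AntitoneOn F (Ico t₀ t₁) := by
    have hsub : Ico t₀ t₁ ⊆ Icc a b := fun s hs => hIsub (Ico_subset_Icc_self hs)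
    have hΛc : ContinuousOn Λ (Ico t₀ t₁) :=
      (hVc.mono hsub).div (hEc.mono hsub) fun s hs => (hEpos s hs).ne'
    have hcont : ContinuousOn F (Ico t₀ t₁) :=
      (hΛc.add continuousOn_const).mul
        ((continuous_const.mul continuous_id').neg.rexp).continuousOn
    refine antitoneOn_of_hasDerivWithinAt_nonpos (f' := F') (convex_Ico t₀ t₁) hcont ?_ ?_
    · intro s hs
      rw [interior_Ico] at hs ⊢
      exact (hFd s hs).hasDerivWithinAt
    · intro s hs
      rw [interior_Ico] at hs
      exact hFsign s hs
  -- hence `Λ ≤ B` on `[t₀, t₁)`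
  set B : ℝ := (Λ t₀ + 1) * Real.exp (K * (t₁ - t₀)) with hB_def
  have hΛ0 : 0 ≤ Λ t₀ := div_nonneg (hV0 t₀ ht₀) hpos.le
  have hΛB : ∀ s ∈ Ico t₀ t₁, Λ s ≤ B := by
    intro s hs
    have h1 : F s ≤ F t₀ := hF (left_mem_Ico.2 ht₀t₁) hs hs.1
    have h2 : (Λ s + 1) * Real.exp (-(K * s)) ≤ (Λ t₀ + 1) * Real.exp (-(K * t₀)) := h1
    have hexp : Real.exp (-(K * t₀)) = Real.exp (K * (s - t₀)) * Real.exp (-(K * s)) := by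
      rw [← Real.exp_add]
      congr 1
      ring
    rw [hexp, ← mul_assoc] at h2
    have h3 : Λ s + 1 ≤ (Λ t₀ + 1) * Real.exp (K * (s - t₀)) :=
      le_of_mul_le_mul_right h2 (Real.exp_pos _)
    have h4 : Real.exp (K * (s - t₀)) ≤ Real.exp (K * (t₁ - t₀)) :=
      Real.exp_le_exp.2 (mul_le_mul_of_nonneg_left (by linarith [hs.2]) hK)
    have h5 : (Λ t₀ + 1) * Real.exp (K * (s - t₀)) ≤ B :=
      mul_le_mul_of_nonneg_left h4 (by linarith)
    linarith
  -- Step 2: `E e^{Mt}` is non-decreasing on `[t₀, t₁]`, `M = αB + β`.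
  set M : ℝ := α * B + β with hM_def
  set G : ℝ → ℝ := fun s => E s * Real.exp (M * s) with hG_def
  set G' : ℝ → ℝ := fun s => (E' s + M * E s) * Real.exp (M * s) with hG'_def
  have hGd : ∀ s ∈ Ioo t₀ t₁, HasDerivAt G (G' s) s := by
    intro s hs
    have hexp : HasDerivAt (fun y => Real.exp (M * y)) (Real.exp (M * s) * (M * 1)) s :=
      ((hasDerivAt_id' s).const_mul M).exp
    refine ((hEd s hs).mul hexp).congr_deriv ?_
    simp only [hG'_def]
    ring
  have hGsign : ∀ s ∈ Ioo t₀ t₁, 0 ≤ G' s := by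
    intro s hs
    have hs' : s ∈ Icc a b := hIsub (Ioo_subset_Icc_self hs)
    have hEs : 0 < E s := hEpos s (Ioo_subset_Ico_self hs)
    have hl := hlow s hs' hEs
    have hVeq : V s = Λ s * E s := by
      simp only [hΛ_def]
      field_simp
    have hVle : V s ≤ B * E s := by
      rw [hVeq]
      exact mul_le_mul_of_nonneg_right (hΛB s (Ioo_subset_Ico_self hs)) hEs.le
    have h1 : 0 ≤ E' s + M * E s := by
      have : α * V s ≤ α * (B * E s) := mul_le_mul_of_nonneg_left hVle hα
      simp only [hM_def]
      nlinarith
    exact mul_nonneg h1 (Real.exp_pos _).le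
  have hG : MonotoneOn G (Icc t₀ t₁) := by
    have hcont : ContinuousOn G (Icc t₀ t₁) :=
      (hEc.mono hIsub).mul ((continuous_const.mul continuous_id').rexp).continuousOn
    refine monotoneOn_of_hasDerivWithinAt_nonneg (f' := G') (convex_Icc t₀ t₁) hcont ?_ ?_
    · intro s hs
      rw [interior_Icc] at hs ⊢
      exact (hGd s hs).hasDerivWithinAt
    · intro s hs
      rw [interior_Icc] at hs
      exact hGsign s hs
  -- Step 3: `0 < E(t₀) e^{Mt₀} ≤ E(t₁) e^{Mt₁} = 0`.
  have h1 : G t₀ ≤ G t₁ := hG (left_mem_Icc.2 ht₀t₁.le) (right_mem_Icc.2 ht₀t₁.le) ht₀t₁.le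
  have h2 : G t₁ = 0 := by simp [hG_def, hEt₁]
  have h3 : 0 < G t₀ := mul_pos hpos (Real.exp_pos _)
  linarith

/-- **No extinction in finite time** (the contrapositive, forward form of
`eq_zero_of_dirichletQuotient_law`, i.e. Temam 1997, Ch. III, Lemma 6.2 read as "`w(t₀) ≠ 0`
implies `w(t) ≠ 0` for `t ≥ t₀`"): under the same one-sided differential inequalities on
`[a, b]`, if `E(t₀) > 0` then `E(t) > 0` for every `t ∈ [t₀, b]` (apply the lemma on `[a, t]`,
to which all hypotheses restrict, `HasDerivWithinAt.mono`). [cite: Temam1997, Ch. III §6.1 Lemma 6.2] -/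
theorem pos_of_dirichletQuotient_law {a b K α β : ℝ} {E V E' V' : ℝ → ℝ}
    (hE : ∀ t ∈ Icc a b, HasDerivWithinAt E (E' t) (Icc a b) t)
    (hV : ∀ t ∈ Icc a b, HasDerivWithinAt V (V' t) (Icc a b) t)
    (hE0 : ∀ t ∈ Icc a b, 0 ≤ E t) (hV0 : ∀ t ∈ Icc a b, 0 ≤ V t) (hK : 0 ≤ K) (hα : 0 ≤ α)
    (hlow : ∀ t ∈ Icc a b, 0 < E t → -(α * V t + β * E t) ≤ E' t)
    (hquot : ∀ t ∈ Icc a b, 0 < E t → V' t * E t - V t * E' t ≤ K * (V t + E t) * E t)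
    {t₀ : ℝ} (ht₀ : t₀ ∈ Icc a b) (hpos : 0 < E t₀) {t : ℝ} (ht : t ∈ Icc a b) (ht₀t : t₀ ≤ t) :
    0 < E t := by
  refine lt_of_le_of_ne (hE0 t ht) fun h0 => hpos.ne' ?_
  have hsub : Icc a t ⊆ Icc a b := Icc_subset_Icc le_rfl ht.2
  exact eq_zero_of_dirichletQuotient_law (a := a) (b := t)
    (fun s hs => (hE s (hsub hs)).mono hsub) (fun s hs => (hV s (hsub hs)).mono hsub)
    (fun s hs => hE0 s (hsub hs)) (fun s hs => hV0 s (hsub hs)) hK hα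
    (fun s hs => hlow s (hsub hs)) (fun s hs => hquot s (hsub hs)) h0.symm ⟨ht₀.1, ht₀t⟩

end Literature.Analysis.ODE

end
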